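import Literature.Combinatorics.StablePolynomials.SupportJumpSystem
import Literature.Combinatorics.StablePolynomials.SamePhase
import Literature.Combinatorics.StablePolynomials.JensenMultipliersMultivariate
import HarnessLib

/-!
# Stable polynomials in the products `z_i w_i` (Borcea–Brändén II, Lemma 4.3): support, symbol, phase

J. Borcea, P. Brändén, *The Lee–Yang and Pólya–Schur programs. II. Theory of stable polynomials and
applications*, Comm. Pure Appl. Math. 62 (2009) 1595–1631 (arXiv:0809.3087), §4:

> **Lemma 4.3.** Let `f(z,w) = Σ_{α ∈ ℕⁿ} a(α) z^α w^α ∈ ℂ[z_1,…,z_n,w_1,…,w_n]`. Then `f` is stable if and only if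
> it can be written as `f(z,w) = C f_1(z_1w_1)⋯f_n(z_nw_n)`, where `C ∈ ℂ` and `f_1(t),…,f_n(t)` are univariate real
> polynomials with real and non-negative zeros only.
>
> *Proof.* […] Suppose that `f(z,w) = Σ a(α) z^α w^α` is stable. We claim that its support `J := supp(f)` has unique
> minimal and maximal elements with respect to the standard partial order on `ℕⁿ`. […] By [Br1] `J` is a jump system
> […]. Let now `ξ, κ` be the minimal, respectively maximal element of `J` and let `T : ℂ_κ[z] → ℂ_κ[z]` be the linear
> operator defined by `T[z^α] = λ(α)z^α = (-1)^α binom(κ,α)^{-1} a(α) z^α`, `0 ≤ α ≤ κ`. […] the algebraic symbol of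
> `T` is given by `G_T(z,w) = Σ_{α ≤ κ} (-1)^α a(α) z^α w^{κ-α} = w^κ f(z,-w^{-1})`, which is stable. By Theorem 3.1
> `T` preserves stability. Since `G_T(z,w)` is homogeneous we may assume that `(-1)^α a(α) ≥ 0` for all `α` in view
> of Lemma 4.2.

This file carries out this first half of the printed proof for `f = g(z_1w_1,…,z_nw_n)` (`diagSubst g`,
`g = Σ a(α) t^α ∈ ℂ[t_τ]`, variables `τ ⊕ τ` with `Sum.inl` = `z`, `Sum.inr` = `w`); the factorisation itself
(the relations `λ(γ)λ(γ+e_i+e_j) = λ(γ+e_i)λ(γ+e_j)` and the splitting `(split)`) is the sequel file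
`StableDiagonalFactorization.lean`.

* §1 `pairExp`, `diagSubst`, `diagSubst_monomial`, `coeff_pairExp_diagSubst` — the support of `f` is the diagonal
  image of `supp(g)`.
* §2 **The two jump-system steps** (`coeff_sub_single_ne_zero`, `coeff_add_single_ne_zero`): if `a(α), a(β) ≠ 0` and
  `β_i < α_i` (resp. `α_i < β_i`) then `a(α - e_i) ≠ 0` (resp. `a(α + e_i) ≠ 0`). This is exactly what the Two-step
  Axiom of [Br1] (tree: `IsUpperHalfPlaneStable.isJumpSystem_support`) yields on the diagonal support: the step
  `(α,α) → (α - e_i, α)` leaves the diagonal and the only second step back onto it is `(α - e_i, α - e_i)`. (The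
  printed text reaches the unique minimum through an auxiliary Hurwitz-limit polynomial `Az_iw_i + Bz_kw_k`; on the
  diagonal the axiom gives the conclusion directly, so Hurwitz' theorem is not needed here.)
* §3 Consequently `supp(g)` is closed under `⊓` and `⊔` and is the whole box `[ξ, κ]` (`coeff_ne_zero_iff_mem_box`),
  `ξ = infVec g`, `κ = degVec g` ("unique minimal and maximal elements"; together with [Br1]'s positivity step
  "`λ(γ) > 0` for all `ξ ≤ γ ≤ κ`").
* §4 The operator `T = diagOp g` (`λ(α) = (-1)^α binom(κ,α)^{-1} a(α)`), its symbol
  `G_T(z,w) = w^κ f(z,-w^{-1})` (`eval_diagOp_symbol`, `symbolSum_eq`), **`diagOp_stable_or_zero`** ("`T` preserves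
  stability", via the tree's Theorem 1.1 `BorceaBranden_stabilityPreserver_iff'`).
* §5 The phase: `diagSymbol g` (the polynomial `G_T`) is homogeneous of degree `|κ|` and stable, so by Lemma 4.2 (tree:
  `IsUpperHalfPlaneStable.hasSamePhase`) some unit `u` makes all `u(-1)^α a(α) ≥ 0` (`exists_phase`); the real
  multipliers `realMultiplier g u α = u λ(α) ∈ ℝ`, positive exactly on the box.

## References

* [BorceaBranden2009II] J. Borcea, P. Brändén, Comm. Pure Appl. Math. 62 (2009) 1595–1631, §4 Lemma 4.3 and its
  proof, Lemma 4.2, Thm 3.1.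
* [Branden2007] P. Brändén, *Polynomials with the half-plane property and matroid theory*, Adv. Math. 216 (2007),
  §2 (Two-step Axiom), §3 Thm. 3.2.
* [BorceaBranden2009] J. Borcea, P. Brändén, Invent. Math. 177 (2009), Thm. 1.1 (the symbol criterion).
-/

noncomputable section

open MvPolynomial Finset

namespace Literature.Combinatorics.StablePolynomials

variable {τ : Type*}

/-! ## §1 Diagonal polynomials `g(z_1w_1, …, z_nw_n)` and their support -/

section Diagonal

/-- The exponent vector `(α, β) ∈ ℕ^{τ ⊕ τ}` of the monomial `z^α w^β`. [cite: BorceaBranden2009II, §4 Lemma 4.3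
(the monomials `z^α w^α`, `z^α w^{κ-α}`)] -/
def pairExp (α β : τ →₀ ℕ) : (τ ⊕ τ) →₀ ℕ :=
  α.sumElim β

/-- `(α,β)` at `z_i`. [cite: BorceaBranden2009II, §4 Lemma 4.3] -/
@[simp] theorem pairExp_inl (α β : τ →₀ ℕ) (i : τ) : pairExp α β (Sum.inl i) = α i := rfl

/-- `(α,β)` at `w_i`. [cite: BorceaBranden2009II, §4 Lemma 4.3] -/
@[simp] theorem pairExp_inr (α β : τ →₀ ℕ) (i : τ) : pairExp α β (Sum.inr i) = β i := rfl

/-- `(α,β) = (α',β')` iff `α = α'` and `β = β'`. [cite: BorceaBranden2009II, §4 Lemma 4.3] -/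
theorem pairExp_eq_pairExp_iff {α β α' β' : τ →₀ ℕ} : pairExp α β = pairExp α' β' ↔ α = α' ∧ β = β' := by
  constructor
  · intro h
    refine ⟨Finsupp.ext fun i => ?_, Finsupp.ext fun i => ?_⟩
    · simpa using DFunLike.congr_fun h (Sum.inl i)
    · simpa using DFunLike.congr_fun h (Sum.inr i)
  · rintro ⟨rfl, rfl⟩
    rfl

/-- Every exponent vector on `τ ⊕ τ` is a pair. [cite: BorceaBranden2009II, §4 Lemma 4.3] -/
theorem exists_eq_pairExp (m : (τ ⊕ τ) →₀ ℕ) : ∃ α β : τ →₀ ℕ, m = pairExp α β :=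
  ⟨(Finsupp.sumFinsuppEquivProdFinsupp m).1, (Finsupp.sumFinsuppEquivProdFinsupp m).2,
    (Finsupp.sumFinsuppEquivProdFinsupp.symm_apply_apply m).symm⟩

/-- `|(α,β)| = |α| + |β|`. [cite: BorceaBranden2009II, §4 Lemma 4.3 ("`G_T(z,w)` is homogeneous")] -/
theorem degree_pairExp [Fintype τ] (α β : τ →₀ ℕ) : (pairExp α β).degree = α.degree + β.degree := by
  rw [Finsupp.degree_eq_sum, Finsupp.degree_eq_sum, Finsupp.degree_eq_sum, Fintype.sum_sum_type]
  rfl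

/-- `z^α w^β = Π z_i^{α_i} · Π w_i^{β_i}` (with coefficient `c`). [cite: BorceaBranden2009II, §4 Lemma 4.3] -/
theorem monomial_pairExp [Fintype τ] (α β : τ →₀ ℕ) (c : ℂ) :
    (monomial (pairExp α β) c : MvPolynomial (τ ⊕ τ) ℂ) =
      C c * ((∏ i, X (Sum.inl i) ^ α i) * ∏ i, X (Sum.inr i) ^ β i) := by
  have h : (∏ s, X s ^ (pairExp α β) s : MvPolynomial (τ ⊕ τ) ℂ) = monomial (pairExp α β) 1 := by
    rw [prod_X_pow_eq_monomial_toF, toF_coe]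
  simp only [Fintype.prod_sum_type, pairExp_inl, pairExp_inr] at h
  conv_lhs => rw [← mul_one c]
  rw [← C_mul_monomial, ← h]

/-- **The diagonal substitution `g ↦ f(z,w) = g(z_1w_1,…,z_nw_n)`** (so that
`f(z,w) = Σ_α a(α) z^α w^α` for `g = Σ_α a(α) t^α`). [cite: BorceaBranden2009II, §4 Lemma 4.3 (the polynomials
`f(z,w) = Σ a(α) z^α w^α`)] -/
def diagSubst : MvPolynomial τ ℂ →ₐ[ℂ] MvPolynomial (τ ⊕ τ) ℂ :=
  bind₁ fun i => X (Sum.inl i) * X (Sum.inr i)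

/-- `f(Z) = g(z_1w_1, …, z_nw_n)` pointwise. [cite: BorceaBranden2009II, §4 Lemma 4.3] -/
theorem eval_diagSubst (Z : τ ⊕ τ → ℂ) (g : MvPolynomial τ ℂ) :
    eval Z (diagSubst g) = eval (fun i => Z (Sum.inl i) * Z (Sum.inr i)) g := by
  rw [diagSubst, eval_bind₁]
  simp only [_root_.map_mul, eval_X]

/-- `diagSubst (c t^α) = c z^α w^α`. [cite: BorceaBranden2009II, §4 Lemma 4.3] -/
theorem diagSubst_monomial (d : τ →₀ ℕ) (r : ℂ) : diagSubst (monomial d r) = monomial (pairExp d d) r := by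
  rw [diagSubst, bind₁_monomial, monomial_eq, Finsupp.prod, pairExp, Finsupp.sumElim_support, prod_disjSum]
  simp only [Finsupp.sumElim_inl, Finsupp.sumElim_inr, mul_pow, prod_mul_distrib]

/-- `f(z,w) = Σ_{α ∈ supp g} a(α) z^α w^α`. [cite: BorceaBranden2009II, §4 Lemma 4.3] -/
theorem diagSubst_eq_sum (g : MvPolynomial τ ℂ) :
    diagSubst g = ∑ α ∈ g.support, monomial (pairExp α α) (coeff α g) := by
  conv_lhs => rw [g.as_sum]
  rw [map_sum]
  exact sum_congr rfl fun α _ => diagSubst_monomial α _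

/-- **The coefficients of `f`**: `[z^α w^β] f = a(α)` if `α = β` and `0` otherwise.
[cite: BorceaBranden2009II, §4 Lemma 4.3 ("`J := supp(f)`")] -/
theorem coeff_pairExp_diagSubst [DecidableEq τ] (g : MvPolynomial τ ℂ) (α β : τ →₀ ℕ) :
    coeff (pairExp α β) (diagSubst g) = if α = β then coeff α g else 0 := by
  rw [diagSubst_eq_sum, coeff_sum]
  simp_rw [coeff_monomial]
  split_ifs with h
  · subst h
    rw [sum_eq_single α (fun γ _ hγ => if_neg fun e => hγ (pairExp_eq_pairExp_iff.1 e).1)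
      (fun hα => by rw [if_pos rfl]; exact notMem_support_iff.1 hα), if_pos rfl]
  · exact sum_eq_zero fun γ _ => if_neg fun e =>
      h ((pairExp_eq_pairExp_iff.1 e).1.symm.trans (pairExp_eq_pairExp_iff.1 e).2)

/-- A nonzero coefficient of `f` sits on the diagonal, at a point of `supp g`.
[cite: BorceaBranden2009II, §4 Lemma 4.3 ("`J := supp(f)`")] -/
theorem exists_eq_pairExp_of_coeff_diagSubst_ne_zero [DecidableEq τ] {g : MvPolynomial τ ℂ}
    {m : (τ ⊕ τ) →₀ ℕ} (h : coeff m (diagSubst g) ≠ 0) : ∃ α, m = pairExp α α ∧ coeff α g ≠ 0 := by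
  obtain ⟨α, β, rfl⟩ := exists_eq_pairExp m
  rw [coeff_pairExp_diagSubst] at h
  split_ifs at h with hαβ
  · exact ⟨α, by rw [hαβ], h⟩
  · exact absurd rfl h

/-- A stable `f = g(zw)` has `g ≠ 0`. [cite: BorceaBranden2009II, §4 Lemma 4.3] -/
theorem ne_zero_of_isUpperHalfPlaneStable_diagSubst {g : MvPolynomial τ ℂ}
    (hst : IsUpperHalfPlaneStable (diagSubst g)) : g ≠ 0 := by
  rintro rfl
  exact hst (fun _ => Complex.I) (fun _ => by simp) (by rw [map_zero, map_zero])

end Diagonal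

/-! ## §2 The two jump-system steps on the diagonal support -/

section Steps

variable [Fintype τ] [DecidableEq τ]

/-- **Down-step.** If `a(α) ≠ 0`, `a(β) ≠ 0` and `β_i < α_i` then `a(α - e_i) ≠ 0`: the Two-step Axiom for the
step `(α,α) → (α-e_i,α)` towards `(β,β)` (which leaves `supp f`) forces `(α-e_i,α-e_i) ∈ supp f`.
[cite: BorceaBranden2009II, §4 proof of Lemma 4.3 ("By [Br1] `J` is a jump system and since `α'' = α - e_i ∉ J`
…")] [cite: Branden2007, §2 (Two-step Axiom), §3 Thm. 3.2] -/
theorem coeff_sub_single_ne_zero {g : MvPolynomial τ ℂ} (hst : IsUpperHalfPlaneStable (diagSubst g))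
    {α β : τ →₀ ℕ} (hα : coeff α g ≠ 0) (hβ : coeff β g ≠ 0) {i : τ} (hi : β i < α i) :
    coeff (α - Finsupp.single i 1) g ≠ 0 := by
  have hJ := hst.isJumpSystem_support
  set α' := α - Finsupp.single i 1 with hα'
  have hα'i : α' i + 1 = α i := by
    rw [hα', Finsupp.tsub_apply, Finsupp.single_apply, if_pos rfl]; omega
  have hα'l : ∀ l, l ≠ i → α' l = α l := fun l hl => by
    rw [hα', Finsupp.tsub_apply, Finsupp.single_apply, if_neg (Ne.symm hl)]; omega
  have hmem : ∀ γ : τ →₀ ℕ, coeff γ g ≠ 0 → pairExp γ γ ∈ {m : (τ ⊕ τ) →₀ ℕ | coeff m (diagSubst g) ≠ 0} :=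
    fun γ hγ => by simpa [coeff_pairExp_diagSubst] using hγ
  -- the step `(α,α) = (α',α) + e_{inl i}`
  have hx : pairExp α α = pairExp α' α + Finsupp.single (Sum.inl i) 1 := by
    ext l
    rcases l with l | l
    · by_cases hl : l = i
      · subst hl
        simp
        omega
      · simp [Ne.symm hl, hα'l l hl]
    · simp
  have hstep : IsStep (pairExp α α) (pairExp β β) (pairExp α' α) :=
    isStep_of_eq_add_single (i := Sum.inl i) (by simpa using hi) hx
  have hγ : pairExp α' α ∉ {m : (τ ⊕ τ) →₀ ℕ | coeff m (diagSubst g) ≠ 0} := by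
    simp only [Set.mem_setOf_eq, not_not, coeff_pairExp_diagSubst]
    rw [if_neg]
    intro h
    have := DFunLike.congr_fun h i
    omega
  obtain ⟨δ, hδstep, hδ⟩ := hJ (hmem α hα) (hmem β hβ) hstep hγ
  obtain ⟨ε, rfl, hε⟩ := exists_eq_pairExp_of_coeff_diagSubst_ne_zero hδ
  suffices hεα : ε = α' by rwa [hεα] at hε
  obtain ⟨j, ⟨hlt, hEq⟩ | ⟨hlt, hEq⟩⟩ := hδstep
  · -- `(ε,ε) = (α',α) + e_j` with `(α',α)_j < (β,β)_j`
    rcases j with k | k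
    · exfalso
      have h1 := DFunLike.congr_fun hEq (Sum.inl k)
      have h2 := DFunLike.congr_fun hEq (Sum.inr k)
      by_cases hk : k = i
      · subst hk
        simp at h1 h2 hlt
        omega
      · simp at h1 h2
        have := hα'l k hk
        omega
    · exfalso
      have h1 := DFunLike.congr_fun hEq (Sum.inl k)
      have h2 := DFunLike.congr_fun hEq (Sum.inr k)
      by_cases hk : k = i
      · subst hk
        simp at h1 h2
        omega
      · simp at h1 h2
        have := hα'l k hk
        omega
  · -- `(α',α) = (ε,ε) + e_j` with `(β,β)_j < (α',α)_j`
    rcases j with k | k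
    · exfalso
      have h1 := DFunLike.congr_fun hEq (Sum.inl k)
      have h2 := DFunLike.congr_fun hEq (Sum.inr k)
      by_cases hk : k = i
      · subst hk
        simp at h1 h2
        omega
      · simp at h1 h2
        have := hα'l k hk
        omega
    · ext l
      have h1 := DFunLike.congr_fun hEq (Sum.inl l)
      simp at h1
      omega

/-- **Up-step.** If `a(α) ≠ 0`, `a(β) ≠ 0` and `α_i < β_i` then `a(α + e_i) ≠ 0`: the Two-step Axiom for the step
`(α,α) → (α+e_i,α)` towards `(β,β)` forces `(α+e_i,α+e_i) ∈ supp f`.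
[cite: BorceaBranden2009II, §4 proof of Lemma 4.3 ("thus providing a unique maximal element for the support `J` of
`f`")] [cite: Branden2007, §2 (Two-step Axiom), §3 Thm. 3.2] -/
theorem coeff_add_single_ne_zero {g : MvPolynomial τ ℂ} (hst : IsUpperHalfPlaneStable (diagSubst g))
    {α β : τ →₀ ℕ} (hα : coeff α g ≠ 0) (hβ : coeff β g ≠ 0) {i : τ} (hi : α i < β i) :
    coeff (α + Finsupp.single i 1) g ≠ 0 := by
  have hJ := hst.isJumpSystem_support
  set α' := α + Finsupp.single i 1 with hα'
  have hα'i : α' i = α i + 1 := by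
    rw [hα', Finsupp.add_apply, Finsupp.single_apply, if_pos rfl]
  have hα'l : ∀ l, l ≠ i → α' l = α l := fun l hl => by
    rw [hα', Finsupp.add_apply, Finsupp.single_apply, if_neg (Ne.symm hl), add_zero]
  have hmem : ∀ γ : τ →₀ ℕ, coeff γ g ≠ 0 → pairExp γ γ ∈ {m : (τ ⊕ τ) →₀ ℕ | coeff m (diagSubst g) ≠ 0} :=
    fun γ hγ => by simpa [coeff_pairExp_diagSubst] using hγ
  -- the step `(α',α) = (α,α) + e_{inl i}`
  have hx : pairExp α' α = pairExp α α + Finsupp.single (Sum.inl i) 1 := by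
    ext l
    rcases l with l | l
    · by_cases hl : l = i
      · subst hl
        simp [hα'i]
      · simp [Ne.symm hl, hα'l l hl]
    · simp
  have hstep : IsStep (pairExp α α) (pairExp β β) (pairExp α' α) := by
    rw [hx]
    exact isStep_add_single (i := Sum.inl i) (by simpa using hi)
  have hγ : pairExp α' α ∉ {m : (τ ⊕ τ) →₀ ℕ | coeff m (diagSubst g) ≠ 0} := by
    simp only [Set.mem_setOf_eq, not_not, coeff_pairExp_diagSubst]
    rw [if_neg]
    intro h
    have := DFunLike.congr_fun h i
    omega
  obtain ⟨δ, hδstep, hδ⟩ := hJ (hmem α hα) (hmem β hβ) hstep hγ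
  obtain ⟨ε, rfl, hε⟩ := exists_eq_pairExp_of_coeff_diagSubst_ne_zero hδ
  suffices hεα : ε = α' by rwa [hεα] at hε
  obtain ⟨j, ⟨hlt, hEq⟩ | ⟨hlt, hEq⟩⟩ := hδstep
  · -- `(ε,ε) = (α',α) + e_j` with `(α',α)_j < (β,β)_j`
    rcases j with k | k
    · exfalso
      have h1 := DFunLike.congr_fun hEq (Sum.inl k)
      have h2 := DFunLike.congr_fun hEq (Sum.inr k)
      by_cases hk : k = i
      · subst hk
        simp at h1 h2
        omega
      · simp at h1 h2
        have := hα'l k hk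
        omega
    · ext l
      have h1 := DFunLike.congr_fun hEq (Sum.inl l)
      simp at h1
      omega
  · -- `(α',α) = (ε,ε) + e_j` with `(β,β)_j < (α',α)_j`
    rcases j with k | k
    · exfalso
      have h1 := DFunLike.congr_fun hEq (Sum.inl k)
      have h2 := DFunLike.congr_fun hEq (Sum.inr k)
      by_cases hk : k = i
      · subst hk
        simp at h1 h2 hlt
        omega
      · simp at h1 h2
        have := hα'l k hk
        omega
    · exfalso
      have h1 := DFunLike.congr_fun hEq (Sum.inl k)
      have h2 := DFunLike.congr_fun hEq (Sum.inr k)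
      by_cases hk : k = i
      · subst hk
        simp at h1 h2
        omega
      · simp at h1 h2
        have := hα'l k hk
        omega

end Steps

/-! ## §3 The support is the box `[ξ, κ]` -/

section Box

variable [Fintype τ] [DecidableEq τ]

/-- **`supp g` is closed under `⊓`** (repeated down-steps). [cite: BorceaBranden2009II, §4 proof of Lemma 4.3
("This shows that `J` has a unique minimal element")] -/
theorem coeff_inf_ne_zero {g : MvPolynomial τ ℂ} (hst : IsUpperHalfPlaneStable (diagSubst g))
    {α β : τ →₀ ℕ} (hα : coeff α g ≠ 0) (hβ : coeff β g ≠ 0) : coeff (α ⊓ β) g ≠ 0 := by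
  suffices H : ∀ (N : ℕ) (α : τ →₀ ℕ), α.degree ≤ N → coeff α g ≠ 0 → coeff (α ⊓ β) g ≠ 0 from
    H _ α le_rfl hα
  intro N
  induction N with
  | zero =>
    intro α hN hα
    have h0 : α = 0 := (Finsupp.degree_eq_zero_iff α).1 (Nat.le_zero.1 hN)
    subst h0
    rwa [show (0 : τ →₀ ℕ) ⊓ β = 0 from Finsupp.ext fun l => by simp]
  | succ N ih =>
    intro α hN hα
    by_cases hle : α ≤ β
    · rwa [inf_eq_left.2 hle]
    · obtain ⟨i, hi⟩ : ∃ i, β i < α i := by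
        by_contra h
        push Not at h
        exact hle (Finsupp.le_def.2 h)
      have hα' := coeff_sub_single_ne_zero hst hα hβ hi
      have hsplit : α = (α - Finsupp.single i 1) + Finsupp.single i 1 := by
        ext l
        rw [Finsupp.add_apply, Finsupp.tsub_apply, Finsupp.single_apply]
        split_ifs with h
        · subst h; omega
        · omega
      have hdeg : (α - Finsupp.single i 1).degree ≤ N := by
        have h2 := congrArg Finsupp.degree hsplit
        rw [map_add, Finsupp.degree_single] at h2
        omega
      have key := ih _ hdeg hα'
      have hinf : (α - Finsupp.single i 1) ⊓ β = α ⊓ β := by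
        ext l
        rw [Finsupp.inf_apply, Finsupp.inf_apply, Finsupp.tsub_apply, Finsupp.single_apply]
        by_cases hl : i = l
        · subst hl
          rw [if_pos rfl, inf_eq_right.2 (by omega : β i ≤ α i - 1), inf_eq_right.2 hi.le]
        · rw [if_neg hl, Nat.sub_zero]
      rwa [hinf] at key

/-- **`supp g` is closed under `⊔`** (repeated up-steps). [cite: BorceaBranden2009II, §4 proof of Lemma 4.3
("a unique maximal element for the support `J` of `f`")] -/
theorem coeff_sup_ne_zero {g : MvPolynomial τ ℂ} (hst : IsUpperHalfPlaneStable (diagSubst g))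
    {α β : τ →₀ ℕ} (hα : coeff α g ≠ 0) (hβ : coeff β g ≠ 0) : coeff (α ⊔ β) g ≠ 0 := by
  suffices H : ∀ (N : ℕ) (α : τ →₀ ℕ), (β - α).degree ≤ N → coeff α g ≠ 0 → coeff (α ⊔ β) g ≠ 0 from
    H _ α le_rfl hα
  intro N
  induction N with
  | zero =>
    intro α hN hα
    have h0 : β - α = 0 := (Finsupp.degree_eq_zero_iff _).1 (Nat.le_zero.1 hN)
    have hle : β ≤ α := Finsupp.le_def.2 fun l => by
      have := DFunLike.congr_fun h0 l
      rw [Finsupp.tsub_apply, Finsupp.coe_zero, Pi.zero_apply] at this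
      omega
    rwa [sup_eq_left.2 hle]
  | succ N ih =>
    intro α hN hα
    by_cases hle : β ≤ α
    · rwa [sup_eq_left.2 hle]
    · obtain ⟨i, hi⟩ : ∃ i, α i < β i := by
        by_contra h
        push Not at h
        exact hle (Finsupp.le_def.2 h)
      have hα' := coeff_add_single_ne_zero hst hα hβ hi
      have hsplit : β - α = (β - (α + Finsupp.single i 1)) + Finsupp.single i 1 := by
        ext l
        rw [Finsupp.add_apply, Finsupp.tsub_apply, Finsupp.tsub_apply, Finsupp.add_apply, Finsupp.single_apply]
        split_ifs with h
        · subst h; omega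
        · omega
      have hdeg : (β - (α + Finsupp.single i 1)).degree ≤ N := by
        have h2 := congrArg Finsupp.degree hsplit
        rw [map_add, Finsupp.degree_single] at h2
        omega
      have key := ih _ hdeg hα'
      have hsup : (α + Finsupp.single i 1) ⊔ β = α ⊔ β := by
        ext l
        rw [Finsupp.sup_apply, Finsupp.sup_apply, Finsupp.add_apply, Finsupp.single_apply]
        by_cases hl : i = l
        · subst hl
          rw [if_pos rfl, sup_eq_right.2 (by omega : α i + 1 ≤ β i), sup_eq_right.2 hi.le]
        · rw [if_neg hl, add_zero]
      rwa [hsup] at key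

/-- **The minimal element `ξ` of `supp g`** (the `⊓` of the support; `0` for `g = 0`).
[cite: BorceaBranden2009II, §4 proof of Lemma 4.3 ("Let now `ξ, κ` be the minimal, respectively maximal element
of `J`")] -/
def infVec (g : MvPolynomial τ ℂ) : τ →₀ ℕ :=
  if h : g.support.Nonempty then g.support.inf' h id else 0

omit [Fintype τ] [DecidableEq τ] in
/-- `ξ ≤ α` for every `α ∈ supp g`. [cite: BorceaBranden2009II, §4 proof of Lemma 4.3] -/
theorem infVec_le {g : MvPolynomial τ ℂ} {α : τ →₀ ℕ} (hα : coeff α g ≠ 0) : infVec g ≤ α := by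
  have hmem : α ∈ g.support := mem_support_iff.2 hα
  rw [infVec, dif_pos ⟨α, hmem⟩]
  exact inf'_le id hmem

/-- **`ξ ∈ supp g`** for stable `f` (the `⊓`-closed support contains its `⊓`).
[cite: BorceaBranden2009II, §4 proof of Lemma 4.3 ("`J` has a unique minimal element")] -/
theorem coeff_infVec_ne_zero {g : MvPolynomial τ ℂ} (hst : IsUpperHalfPlaneStable (diagSubst g)) :
    coeff (infVec g) g ≠ 0 := by
  have hne : g.support.Nonempty := support_nonempty.2 (ne_zero_of_isUpperHalfPlaneStable_diagSubst hst)
  rw [infVec, dif_pos hne]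
  have h := inf'_mem {α : τ →₀ ℕ | coeff α g ≠ 0}
    (fun x hx y hy => coeff_inf_ne_zero hst hx hy) g.support hne id (fun α hα => mem_support_iff.1 hα)
  exact h

/-- **`κ = degVec g ∈ supp g`** for stable `f` (the `⊔`-closed support contains its `⊔`, which is the vector of
partial degrees). [cite: BorceaBranden2009II, §4 proof of Lemma 4.3 ("a unique maximal element for the support
`J` of `f`")] -/
theorem coeff_degVec_ne_zero {g : MvPolynomial τ ℂ} (hst : IsUpperHalfPlaneStable (diagSubst g)) :
    coeff (degVec g) g ≠ 0 := by
  have hne : g.support.Nonempty := support_nonempty.2 (ne_zero_of_isUpperHalfPlaneStable_diagSubst hst)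
  set M := g.support.sup' hne id with hM
  have hMmem : coeff M g ≠ 0 :=
    sup'_mem {α : τ →₀ ℕ | coeff α g ≠ 0} (fun x hx y hy => coeff_sup_ne_zero hst hx hy) g.support hne id
      (fun α hα => mem_support_iff.1 hα)
  have hMeq : M = degVec g := by
    refine le_antisymm (le_degVec hMmem) (Finsupp.le_def.2 fun i => ?_)
    rw [degVec_apply, degreeOf_eq_sup]
    obtain ⟨m, hm, hmeq⟩ := exists_mem_eq_sup g.support hne (fun m : τ →₀ ℕ => m i)
    rw [hmeq]
    exact Finsupp.le_def.1 (le_sup' id hm : m ≤ M) i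
  rwa [hMeq] at hMmem

/-- **The support of `g` is the box `[ξ, κ]`**: `a(γ) ≠ 0 ↔ ξ ≤ γ ≤ κ` (`ξ = infVec g`, `κ = degVec g`).
[cite: BorceaBranden2009II, §4 proof of Lemma 4.3 ("`λ(γ) > 0` for all `ξ ≤ γ ≤ κ`")]
[cite: Branden2007, §3 Cor. 3.7 (no internal zeros)] -/
theorem coeff_ne_zero_iff_mem_box {g : MvPolynomial τ ℂ} (hst : IsUpperHalfPlaneStable (diagSubst g))
    (γ : τ →₀ ℕ) : coeff γ g ≠ 0 ↔ infVec g ≤ γ ∧ γ ≤ degVec g := by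
  refine ⟨fun h => ⟨infVec_le h, le_degVec h⟩, fun ⟨h1, h2⟩ => ?_⟩
  -- walk up from `ξ` to `γ` by up-steps towards `κ`
  suffices H : ∀ (N : ℕ) (γ : τ →₀ ℕ), infVec g ≤ γ → γ ≤ degVec g → (γ - infVec g).degree ≤ N →
      coeff γ g ≠ 0 from H _ γ h1 h2 le_rfl
  intro N
  induction N with
  | zero =>
    intro γ h1 _ hN
    have h0 : γ - infVec g = 0 := (Finsupp.degree_eq_zero_iff _).1 (Nat.le_zero.1 hN)
    have hle : γ ≤ infVec g := Finsupp.le_def.2 fun l => by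
      have := DFunLike.congr_fun h0 l
      rw [Finsupp.tsub_apply, Finsupp.coe_zero, Pi.zero_apply] at this
      omega
    rw [le_antisymm hle h1]
    exact coeff_infVec_ne_zero hst
  | succ N ih =>
    intro γ h1 h2 hN
    by_cases heq : γ = infVec g
    · rw [heq]; exact coeff_infVec_ne_zero hst
    · obtain ⟨i, hi⟩ : ∃ i, infVec g i < γ i := by
        by_contra h
        push Not at h
        exact heq (le_antisymm (Finsupp.le_def.2 h) h1)
      set γ' := γ - Finsupp.single i 1 with hγ'
      have hγ'i : γ' i + 1 = γ i := by
        rw [hγ', Finsupp.tsub_apply, Finsupp.single_apply, if_pos rfl]; omega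
      have hγ'l : ∀ l, l ≠ i → γ' l = γ l := fun l hl => by
        rw [hγ', Finsupp.tsub_apply, Finsupp.single_apply, if_neg (Ne.symm hl)]; omega
      have h1' : infVec g ≤ γ' := Finsupp.le_def.2 fun l => by
        by_cases hl : l = i
        · subst hl; omega
        · rw [hγ'l l hl]; exact Finsupp.le_def.1 h1 l
      have h2' : γ' ≤ degVec g := Finsupp.le_def.2 fun l => by
        by_cases hl : l = i
        · subst hl; have := Finsupp.le_def.1 h2 l; omega
        · rw [hγ'l l hl]; exact Finsupp.le_def.1 h2 l
      have hN' : (γ' - infVec g).degree ≤ N := by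
        have hsplit : γ - infVec g = (γ' - infVec g) + Finsupp.single i 1 := by
          ext l
          rw [Finsupp.add_apply, Finsupp.tsub_apply, Finsupp.tsub_apply, Finsupp.single_apply]
          by_cases hl : l = i
          · subst hl; rw [if_pos rfl]; omega
          · rw [if_neg (Ne.symm hl), hγ'l l hl, add_zero]
        have h3 := congrArg Finsupp.degree hsplit
        rw [map_add, Finsupp.degree_single] at h3
        omega
      have hγ'c := ih γ' h1' h2' hN'
      have hlt : γ' i < degVec g i := by have := Finsupp.le_def.1 h2 i; omega
      have hup := coeff_add_single_ne_zero hst hγ'c (coeff_degVec_ne_zero hst) hlt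
      have heq' : γ' + Finsupp.single i 1 = γ := by
        ext l
        rw [Finsupp.add_apply, Finsupp.single_apply]
        by_cases hl : l = i
        · subst hl; rw [if_pos rfl]; omega
        · rw [if_neg (Ne.symm hl), hγ'l l hl, add_zero]
      rwa [heq'] at hup

/-- `ξ ≤ κ`. [cite: BorceaBranden2009II, §4 proof of Lemma 4.3] -/
theorem infVec_le_degVec {g : MvPolynomial τ ℂ} (hst : IsUpperHalfPlaneStable (diagSubst g)) :
    infVec g ≤ degVec g :=
  infVec_le (coeff_degVec_ne_zero hst)

end Box

/-! ## §4 The operator `T[z^α] = (-1)^α binom(κ,α)^{-1} a(α) z^α` and its symbol -/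

section Operator

variable [Fintype τ] [DecidableEq τ]

/-- **The multipliers `λ(α) = (-1)^α binom(κ,α)^{-1} a(α)`** (`κ = degVec g`, `|α| = α.degree`).
[cite: BorceaBranden2009II, §4 proof of Lemma 4.3 (definition of `T`)] -/
def diagMultiplier (g : MvPolynomial τ ℂ) (α : τ →₀ ℕ) : ℂ :=
  (-1) ^ α.degree * (∏ i, (((degVec g i).choose (α i) : ℕ) : ℂ))⁻¹ * coeff α g

/-- **The operator `T : ℂ_κ[z] → ℂ_κ[z]`, `T[z^α] = λ(α) z^α`.** [cite: BorceaBranden2009II, §4 proof of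
Lemma 4.3 (definition of `T`)] -/
def diagOp (g : MvPolynomial τ ℂ) : MvPolynomial τ ℂ →ₗ[ℂ] MvPolynomial τ ℂ :=
  mvMultiplierOp (diagMultiplier g)

omit [DecidableEq τ] in
/-- `T(c z^α) = λ(α) c z^α`. [cite: BorceaBranden2009II, §4 proof of Lemma 4.3] -/
theorem diagOp_monomial (g : MvPolynomial τ ℂ) (α : τ →₀ ℕ) (c : ℂ) :
    diagOp g (monomial α c) = monomial α (diagMultiplier g α * c) :=
  mvMultiplierOp_monomial _ _ _

omit [DecidableEq τ] in
/-- `binom(κ,α) = Π_i binom(κ_i,α_i) ≠ 0` for `α ≤ κ`. [cite: BorceaBranden2009II, §4 proof of Lemma 4.3] -/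
theorem prod_choose_ne_zero {κ α : τ →₀ ℕ} (h : α ≤ κ) :
    (∏ i, (((κ i).choose (α i) : ℕ) : ℂ)) ≠ 0 :=
  prod_ne_zero_iff.2 fun i _ => Nat.cast_ne_zero.2 (Nat.choose_pos (Finsupp.le_def.1 h i)).ne'

/-- **The symbol sum `S(z,w) = Σ_{α ∈ supp g} (-1)^α a(α) z^α w^{κ-α}`.**
[cite: BorceaBranden2009II, §4 proof of Lemma 4.3 ("`G_T(z,w) = Σ_{α≤κ} (-1)^α a(α) z^α w^{κ-α}`")] -/
def symbolSum (g : MvPolynomial τ ℂ) (z w : τ → ℂ) : ℂ :=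
  ∑ α ∈ g.support, (-1) ^ α.degree * coeff α g * ((∏ i, z i ^ α i) * ∏ i, w i ^ (degVec g i - α i))

/-- Reindexing a sum over the box `m ≤ κ` (functions) to `supp g`, for summands vanishing off the support.
[cite: BorceaBranden2009II, §4 proof of Lemma 4.3 (the sums `Σ_{α ≤ κ}`)] -/
theorem sum_box_eq_sum_support {M : Type*} [AddCommMonoid M] (g : MvPolynomial τ ℂ) (G : (τ →₀ ℕ) → M)
    (hG : ∀ α, coeff α g = 0 → G α = 0) :
    ∑ m ∈ Fintype.piFinset (fun i => range (degVec g i + 1)), G (toF m) = ∑ α ∈ g.support, G α := by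
  have hsub : g.support ⊆ (Fintype.piFinset fun i => range (degVec g i + 1)).image toF := by
    intro s hs
    refine mem_image.2 ⟨⇑s, mem_box_iff.2 fun i => ?_, toF_coe s⟩
    rw [degVec_apply]
    exact monomial_le_degreeOf i hs
  have hinj : Set.InjOn (toF : (τ → ℕ) → τ →₀ ℕ) ↑(Fintype.piFinset fun i => range (degVec g i + 1)) :=
    fun m _ m' _ h => funext fun i => by rw [← toF_apply m i, h, toF_apply]
  rw [← sum_image hinj]
  symm
  exact sum_subset hsub fun s _ hs => hG s (notMem_support_iff.1 hs)

/-- **`T[Π_i(z_i+w_i)^{κ_i}](z) = S(z,w)`.** [cite: BorceaBranden2009II, §4 proof of Lemma 4.3 ("the algebraic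
symbol of `T` is given by `G_T(z,w) = Σ_{α≤κ} (-1)^α a(α) z^α w^{κ-α}`")] -/
theorem eval_diagOp_symbol (g : MvPolynomial τ ℂ) (z w : τ → ℂ) :
    eval z (diagOp g (∏ i, (X i + C (w i)) ^ degVec g i)) = symbolSum g z w := by
  rw [diagOp, eval_mvMultiplierOp_prod_X_add_C_pow, symbolSum]
  have h := sum_box_eq_sum_support g (fun α => diagMultiplier g α *
      ∏ i, ((((degVec g i).choose (α i) : ℕ) : ℂ) * z i ^ α i * w i ^ (degVec g i - α i)))
    (fun α hα => by rw [diagMultiplier, hα, mul_zero, zero_mul])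
  simp only [toF_apply] at h
  rw [h]
  refine sum_congr rfl fun α hα => ?_
  have hακ : α ≤ degVec g := le_degVec (mem_support_iff.1 hα)
  have hb := prod_choose_ne_zero hακ
  rw [prod_mul_distrib, prod_mul_distrib, diagMultiplier]
  calc (-1) ^ α.degree * (∏ i, (((degVec g i).choose (α i) : ℕ) : ℂ))⁻¹ * coeff α g *
        (((∏ i, (((degVec g i).choose (α i) : ℕ) : ℂ)) * ∏ i, z i ^ α i) * ∏ i, w i ^ (degVec g i - α i))
      = (-1) ^ α.degree * coeff α g *
          (((∏ i, (((degVec g i).choose (α i) : ℕ) : ℂ))⁻¹ * ∏ i, (((degVec g i).choose (α i) : ℕ) : ℂ)) *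
            ((∏ i, z i ^ α i) * ∏ i, w i ^ (degVec g i - α i))) := by ring
    _ = _ := by rw [inv_mul_cancel₀ hb, one_mul]

omit [DecidableEq τ] in
/-- **`S(z,w) = w^κ f(z,-w^{-1})`** for `w_i ≠ 0`. [cite: BorceaBranden2009II, §4 proof of Lemma 4.3
("`= w^κ f(z,-w^{-1})`")] -/
theorem symbolSum_eq (g : MvPolynomial τ ℂ) (z w : τ → ℂ) (hw : ∀ i, w i ≠ 0) :
    symbolSum g z w = (∏ i, w i ^ degVec g i) * eval (Sum.elim z fun i => -(w i)⁻¹) (diagSubst g) := by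
  rw [eval_diagSubst, symbolSum, MvPolynomial.eval_eq', mul_sum]
  refine sum_congr rfl fun α hα => ?_
  have hακ : α ≤ degVec g := le_degVec (mem_support_iff.1 hα)
  simp only [Sum.elim_inl, Sum.elim_inr]
  have hterm : ∀ i, w i ^ degVec g i * (z i * -(w i)⁻¹) ^ α i =
      (-1) ^ α i * (z i ^ α i * w i ^ (degVec g i - α i)) := by
    intro i
    obtain ⟨e, he⟩ := Nat.exists_eq_add_of_le (Finsupp.le_def.1 hακ i)
    rw [he, Nat.add_sub_cancel_left, pow_add, mul_pow, neg_pow, inv_pow]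
    have hwi : w i ^ α i ≠ 0 := pow_ne_zero _ (hw i)
    field_simp
  symm
  calc (∏ i, w i ^ degVec g i) * (coeff α g * ∏ i, (z i * -(w i)⁻¹) ^ α i)
      = coeff α g * ∏ i, (w i ^ degVec g i * (z i * -(w i)⁻¹) ^ α i) := by rw [prod_mul_distrib]; ring
    _ = coeff α g * ∏ i, ((-1) ^ α i * (z i ^ α i * w i ^ (degVec g i - α i))) := by
        rw [prod_congr rfl fun i _ => hterm i]
    _ = _ := by
        rw [prod_mul_distrib, prod_mul_distrib, prod_pow_eq_pow_sum, ← Finsupp.degree_eq_sum]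
        ring

omit [DecidableEq τ] in
/-- **`S(z,w) ≠ 0` on `H^τ × H^τ`** for stable `f`. [cite: BorceaBranden2009II, §4 proof of Lemma 4.3 ("which is
stable")] -/
theorem symbolSum_ne_zero {g : MvPolynomial τ ℂ} (hst : IsUpperHalfPlaneStable (diagSubst g)) {z w : τ → ℂ}
    (hz : ∀ i, 0 < (z i).im) (hw : ∀ i, 0 < (w i).im) : symbolSum g z w ≠ 0 := by
  have hw0 : ∀ i, w i ≠ 0 := fun i h => by
    have := hw i
    rw [h, Complex.zero_im] at this
    exact lt_irrefl _ this
  rw [symbolSum_eq g z w hw0]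
  refine mul_ne_zero (prod_ne_zero_iff.2 fun i _ => pow_ne_zero _ (hw0 i)) (hst _ fun s => ?_)
  rcases s with i | i
  · exact hz i
  · exact neg_inv_im_pos (hw i)

/-- **The symbol `G_T(z,w) = T[(z+w)^κ]` is stable.** [cite: BorceaBranden2009II, §4 proof of Lemma 4.3
("`G_T(z,w) = w^κ f(z,-w^{-1})`, which is stable")] -/
theorem isUpperHalfPlaneStable_boundedDegreeSymbol_diagOp {g : MvPolynomial τ ℂ}
    (hst : IsUpperHalfPlaneStable (diagSubst g)) :
    IsUpperHalfPlaneStable (boundedDegreeSymbol (fun i => degVec g i) (diagOp g)) := by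
  rw [isUpperHalfPlaneStable_boundedDegreeSymbol_iff]
  intro z w hz hw
  rw [eval_diagOp_symbol]
  exact symbolSum_ne_zero hst hz hw

/-- **"By Theorem 3.1 `T` preserves stability"**: `T` maps stable polynomials of `ℂ_κ[z]` to stable polynomials
or to `0`. [cite: BorceaBranden2009II, §4 proof of Lemma 4.3] [cite: BorceaBranden2009, §1.1 Thm. 1.1] -/
theorem diagOp_stable_or_zero {g : MvPolynomial τ ℂ} (hst : IsUpperHalfPlaneStable (diagSubst g))
    {p : MvPolynomial τ ℂ} (hp : ∀ i, degreeOf i p ≤ degVec g i) (hs : IsUpperHalfPlaneStable p) :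
    IsUpperHalfPlaneStable (diagOp g p) ∨ diagOp g p = 0 :=
  (BorceaBranden_stabilityPreserver_iff' (fun i => degVec g i) (diagOp g)).2
    (Or.inr (isUpperHalfPlaneStable_boundedDegreeSymbol_diagOp hst)) p hp hs

end Operator

/-! ## §5 The phase of the coefficients `(-1)^α a(α)` -/

section Phase

variable [Fintype τ] [DecidableEq τ]

/-- **The symbol polynomial `G_T(z,w) = Σ_{α} (-1)^α a(α) z^α w^{κ-α}`** as an element of `ℂ[z_τ,w_τ]`.
[cite: BorceaBranden2009II, §4 proof of Lemma 4.3 ("`G_T(z,w)`")] -/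
def diagSymbol (g : MvPolynomial τ ℂ) : MvPolynomial (τ ⊕ τ) ℂ :=
  ∑ α ∈ g.support, monomial (pairExp α (degVec g - α)) ((-1) ^ α.degree * coeff α g)

omit [DecidableEq τ] in
/-- `G_T(z,w) = S(z,w)` pointwise. [cite: BorceaBranden2009II, §4 proof of Lemma 4.3] -/
theorem eval_diagSymbol (g : MvPolynomial τ ℂ) (z w : τ → ℂ) :
    eval (Sum.elim z w) (diagSymbol g) = symbolSum g z w := by
  rw [diagSymbol, map_sum, symbolSum]
  refine sum_congr rfl fun α _ => ?_
  rw [monomial_pairExp, _root_.map_mul, eval_C, _root_.map_mul, _root_.map_prod, _root_.map_prod]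
  simp only [map_pow, eval_X, Sum.elim_inl, Sum.elim_inr, Finsupp.tsub_apply, degVec_apply]

omit [DecidableEq τ] in
/-- **`G_T` is homogeneous of degree `|κ|`.** [cite: BorceaBranden2009II, §4 proof of Lemma 4.3 ("Since
`G_T(z,w)` is homogeneous")] -/
theorem isHomogeneous_diagSymbol (g : MvPolynomial τ ℂ) : (diagSymbol g).IsHomogeneous (degVec g).degree := by
  refine IsHomogeneous.sum _ _ _ fun α hα => isHomogeneous_monomial _ ?_
  have hακ : α ≤ degVec g := le_degVec (mem_support_iff.1 hα)
  rw [degree_pairExp, Finsupp.degree_eq_sum, Finsupp.degree_eq_sum, Finsupp.degree_eq_sum, ← sum_add_distrib]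
  exact sum_congr rfl fun i _ => by rw [Finsupp.tsub_apply]; exact Nat.add_sub_cancel' (Finsupp.le_def.1 hακ i)

omit [DecidableEq τ] in
/-- **`G_T` is stable** for stable `f`. [cite: BorceaBranden2009II, §4 proof of Lemma 4.3 ("which is stable")] -/
theorem isUpperHalfPlaneStable_diagSymbol {g : MvPolynomial τ ℂ} (hst : IsUpperHalfPlaneStable (diagSubst g)) :
    IsUpperHalfPlaneStable (diagSymbol g) := by
  intro Z hZ
  rw [← Sum.elim_comp_inl_inr Z, eval_diagSymbol]
  exact symbolSum_ne_zero hst (fun i => hZ _) (fun i => hZ _)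

/-- The coefficient of `z^α w^{κ-α}` in `G_T` is `(-1)^α a(α)`. [cite: BorceaBranden2009II, §4 proof of
Lemma 4.3] -/
theorem coeff_diagSymbol (g : MvPolynomial τ ℂ) (α : τ →₀ ℕ) :
    coeff (pairExp α (degVec g - α)) (diagSymbol g) = (-1) ^ α.degree * coeff α g := by
  rw [diagSymbol, coeff_sum]
  simp_rw [coeff_monomial]
  by_cases hα : α ∈ g.support
  · rw [sum_eq_single α (fun γ _ hγ => if_neg fun e => hγ (pairExp_eq_pairExp_iff.1 e).1)
      (fun h => absurd hα h), if_pos rfl]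
  · rw [sum_eq_zero fun γ hγ => if_neg fun e => hα (by rw [← (pairExp_eq_pairExp_iff.1 e).1]; exact hγ),
      notMem_support_iff.1 hα, mul_zero]

/-- **"Since `G_T(z,w)` is homogeneous we may assume that `(-1)^α a(α) ≥ 0` for all `α` in view of Lemma 4.2"**:
some unit `u` makes every `u (-1)^α a(α)` a non-negative real. [cite: BorceaBranden2009II, §4 proof of
Lemma 4.3, Lemma 4.2] -/
theorem exists_phase {g : MvPolynomial τ ℂ} (hst : IsUpperHalfPlaneStable (diagSubst g)) :
    ∃ u : ℂ, ‖u‖ = 1 ∧ ∀ α : τ →₀ ℕ,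
      (u * ((-1) ^ α.degree * coeff α g)).im = 0 ∧ 0 ≤ (u * ((-1) ^ α.degree * coeff α g)).re := by
  obtain ⟨u, hu, h⟩ := (isUpperHalfPlaneStable_diagSymbol hst).hasSamePhase (isHomogeneous_diagSymbol g)
  refine ⟨u, hu, fun α => ?_⟩
  have := h (pairExp α (degVec g - α))
  rwa [coeff_diagSymbol] at this

/-- **The normalised real multipliers `μ(α) = u λ(α) = Re(u (-1)^α a(α)) / binom(κ,α)`.**
[cite: BorceaBranden2009II, §4 proof of Lemma 4.3 ("we may assume that `(-1)^α a(α) ≥ 0`")] -/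
def realMultiplier (g : MvPolynomial τ ℂ) (u : ℂ) (α : τ →₀ ℕ) : ℝ :=
  (u * ((-1) ^ α.degree * coeff α g)).re / ∏ i, (((degVec g i).choose (α i) : ℕ) : ℝ)

omit [DecidableEq τ] in
/-- `μ(α) = u λ(α)` (as complex numbers) for a phase `u` as in `exists_phase`.
[cite: BorceaBranden2009II, §4 proof of Lemma 4.3] -/
theorem realMultiplier_eq {g : MvPolynomial τ ℂ} {u : ℂ}
    (hu : ∀ α : τ →₀ ℕ, (u * ((-1) ^ α.degree * coeff α g)).im = 0 ∧ 0 ≤ (u * ((-1) ^ α.degree * coeff α g)).re)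
    (α : τ →₀ ℕ) : (realMultiplier g u α : ℂ) = u * diagMultiplier g α := by
  by_cases hα : coeff α g = 0
  · simp [realMultiplier, diagMultiplier, hα]
  · have hακ : α ≤ degVec g := le_degVec hα
    have hre : ((u * ((-1) ^ α.degree * coeff α g)).re : ℂ) = u * ((-1) ^ α.degree * coeff α g) :=
      Complex.ext (by simp) (by rw [Complex.ofReal_im, (hu α).1])
    have hprod : ((∏ i, (((degVec g i).choose (α i) : ℕ) : ℝ) : ℝ) : ℂ) =
        ∏ i, (((degVec g i).choose (α i) : ℕ) : ℂ) := by
      push_cast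
      rfl
    rw [realMultiplier, Complex.ofReal_div, hre, hprod, diagMultiplier]
    field_simp [prod_choose_ne_zero hακ]

omit [DecidableEq τ] in
/-- `μ(α) ≥ 0`. [cite: BorceaBranden2009II, §4 proof of Lemma 4.3 ("`(-1)^α a(α) ≥ 0`")] -/
theorem realMultiplier_nonneg {g : MvPolynomial τ ℂ} {u : ℂ}
    (hu : ∀ α : τ →₀ ℕ, (u * ((-1) ^ α.degree * coeff α g)).im = 0 ∧ 0 ≤ (u * ((-1) ^ α.degree * coeff α g)).re)
    (α : τ →₀ ℕ) : 0 ≤ realMultiplier g u α :=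
  div_nonneg (hu α).2 (prod_nonneg fun _ _ => Nat.cast_nonneg _)

/-- **`μ(γ) > 0` exactly on the box `ξ ≤ γ ≤ κ`** ("From (lambdas) and [Br1] we deduce that `λ(γ) > 0` for all
`ξ ≤ γ ≤ κ`"). [cite: BorceaBranden2009II, §4 proof of Lemma 4.3] -/
theorem realMultiplier_pos_iff {g : MvPolynomial τ ℂ} (hst : IsUpperHalfPlaneStable (diagSubst g)) {u : ℂ}
    (hu1 : ‖u‖ = 1)
    (hu : ∀ α : τ →₀ ℕ, (u * ((-1) ^ α.degree * coeff α g)).im = 0 ∧ 0 ≤ (u * ((-1) ^ α.degree * coeff α g)).re)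
    (γ : τ →₀ ℕ) : 0 < realMultiplier g u γ ↔ infVec g ≤ γ ∧ γ ≤ degVec g := by
  rw [← coeff_ne_zero_iff_mem_box hst]
  constructor
  · intro h hγ
    simp [realMultiplier, hγ] at h
  · intro hγ
    have hu0 : u ≠ 0 := fun h => by rw [h, norm_zero] at hu1; exact zero_ne_one hu1
    have hne : u * ((-1) ^ γ.degree * coeff γ g) ≠ 0 :=
      mul_ne_zero hu0 (mul_ne_zero (pow_ne_zero _ (by norm_num)) hγ)
    have hre : 0 < (u * ((-1) ^ γ.degree * coeff γ g)).re := by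
      rcases (hu γ).2.lt_or_eq with h | h
      · exact h
      · exact absurd (Complex.ext (by rw [Complex.zero_re]; exact h)
          (by rw [Complex.zero_im]; exact (hu γ).1.symm)) hne.symm
    exact div_pos hre (prod_pos fun i _ => Nat.cast_pos.2 (Nat.choose_pos (Finsupp.le_def.1 (le_degVec hγ) i)))

omit [DecidableEq τ] in
/-- `μ(γ) = 0` off the support. [cite: BorceaBranden2009II, §4 proof of Lemma 4.3] -/
theorem realMultiplier_eq_zero {g : MvPolynomial τ ℂ} (u : ℂ) {γ : τ →₀ ℕ} (hγ : coeff γ g = 0) :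
    realMultiplier g u γ = 0 := by
  simp [realMultiplier, hγ]

end Phase

end Literature.Combinatorics.StablePolynomials

end
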